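import Literature.AlgebraicGeometry.HodgeTheory.CMAbelianVarietyHodgeLieTorusOfNondegenerate
import Literature.AlgebraicGeometry.HodgeTheory.CMAbelianVarietyHodgeGroupRealPointsCompactForm
import Literature.AlgebraicGeometry.Motives.HodgeEndActionEigenlineSkewCommutant
import Literature.AlgebraicGeometry.Motives.HodgeStructureStrongCMGaloisPolarization
import Literature.AlgebraicGeometry.HodgeTheory.HodgeEndomorphismsHOneOfRiemann
import HarnessLib

/-!
# The two CM-factor inputs of the Weil PRODUCT brick, read on `H¹(Z)` of a SIMPLE CM abelian variety of prime dimension: `Lie Hg(H¹Z)` is ABELIAN, and every endomorphism-commuting `ψ`-skew operator lies in `Lie Hg(H¹Z) ⊗ ℂ` (Moonen–Zarhin 1999 §2 (2.1)–(2.3), Thm. (2.7); Shimura §5.1 Lemma 2; Deligne I §3)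

Family `hodge`, layer `Literature/AlgebraicGeometry/HodgeTheory`.  Cell `pub-hodgeav-hg6` (TABLE X row 22 `Y₃ × Z₃`: the
hypotheses `hab₂` and `hY₂` of the brick `WeilProductCM.mem_hodgeLieC_of_commute_of_skew_of_trace_of_abelian`
(`Motives/HodgeLieUnitaryTimesCMSummandSU`) for the CM factor `Z₃`, packaged on `Z` alone; nothing here proves HC, HC_AV
or HC_CM).  UNCONDITIONAL; theorems only, no definition, no named fact, no instance, no `sorry`.

For a realisation `h : IsCMTypeRealisation Φ Z ι θ` of a CM type `(K; Φ)` and `H_Z = BettiUniverse.hodge hHD (isSmoothProjective_holds) 1`: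
* §1 **`CMTorusTheta.hodgeLie_comm_of_isCMTypeRealisation`** — `Lie Hg(H¹Z)` is commutative (`Z` is of CM type,
  `IsCMTypeRealisation.isOfCMType`; `Lie Hg ⊆ End_Hdg`, `hodgeLie_hodge_le_endAlg_of_isOfCMType`; `Lie Hg` commutes with
  `End_Hdg`).
* §2 **`CMTorusTheta.isCompatible_cmEndAction_of_isSimple`** — for `Z` SIMPLE, EVERY polarization `ψ` of `H¹(Z)` is
  compatible with the CM action, `ψ(kv, w) = ψ(v, k̄w)` (`End_Hdg(H¹Z) = K` by Riemann + `dim End⁰(Z) = [K:ℚ]`, so the Rosati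
  involution preserves the action and is complex conjugation — the tree's `EndAction.adjoint_ι_eq_ι_complexConj`).
* §3 **`CMTorusTheta.mem_hodgeLieC_of_forall_commute_pull_of_skew`** — for `Z` SIMPLE of PRIME dimension (so every simple CM
  threefold): every operator on `H¹(Z;ℚ) ⊗ ℂ` commuting with `(g^*)_ℂ` for all `g ∈ End(Z)` and skew for `ψ_ℂ` (any `ψ`) lies in
  `Lie Hg(H¹Z) ⊗ ℂ` (the tree's eigenline skew-commutant theorem `mem_spanC_map_of_commute_of_skew` puts it in `(K⁻ ·)_ℂ`, and
  `K⁻ · ⊆ Lie Hg` is the torus maximality `CMTorusTheta.cmAction_mem_of_theta_mem_of_isSimple_of_prime`).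

## References
* [MoonenZarhin1999LowDim] B. Moonen, Yu. Zarhin, Math. Ann. 315 (1999), §2 (2.1)–(2.3), Thm. (2.7), §3 (3.1).
* [Shimura1998] G. Shimura, *Abelian Varieties with Complex Multiplication and Modular Functions* (1998), §5.1 Lemma 2, Prop. 6.
* [Deligne1982HodgeCycles] P. Deligne, LNM 900 (1982), I §3 Prop. 3.4, §4, Ex. 3.7.
* [vanGeemen1994HodgeAV] B. van Geemen, LNM 1594 (1994), Lemma 5.2 (1).
-/

noncomputable section

open scoped TensorProduct
open Module NumberField CategoryTheory

namespace Literature.AlgebraicGeometry.HodgeTheory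

open Literature.AlgebraicTopology.SingularHomology
open Literature.AlgebraicGeometry.Motives (IsSmoothProjective AbelianVariety bettiCohomology CMType HodgeTensorFacts)
open Literature.AlgebraicGeometry.Motives.HodgeStructure
open Literature.AlgebraicGeometry.ComplexMultiplication (IsCMTypeRealisation cmAction_eq_pull)
open Literature.AlgebraicGeometry.Milne1999 (IsOfCMType)
open Literature.AlgebraicGeometry.Pohlmann1968 (finrank_eq_two_mul_dim_of_isCMTypeRealisation)

variable {K : Type} [Field K] [NumberField K] {Φ : CMType K} {Z : AbelianVariety ℂ} {ι : 𝓞 K →+* End Z}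
  {θ : K →+* Module.End ℂ (complexBetti Z.X 1)}

/-! ### §1 `Lie Hg(H¹Z)` is commutative -/

/-- **The Hodge Lie algebra of a CM abelian variety is ABELIAN** («`Hg(X)` is a torus iff `X` is of CM type», Lie form):
`Lie Hg(H¹Z) ⊆ End_Hdg(H¹Z)` (`hodgeLie_hodge_le_endAlg_of_isOfCMType`) and `Lie Hg` commutes with `End_Hdg`.  This is the
hypothesis `hab₂` of the product brick for the CM factor. [cite: MoonenZarhin1999LowDim, §2 (2.1)–(2.2)]
[cite: Deligne1982HodgeCycles, I Ex. 3.7] -/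
theorem CMTorusTheta.hodgeLie_comm_of_isCMTypeRealisation [IsCMField K] [HodgeTensorFacts.{0, 0}]
    (h : IsCMTypeRealisation Φ Z ι θ)
    (hHD : exists_isReal_hodgeModel) (hI : hodgePQ_independent_of_hodgeModel) :
    ∀ X ∈ (BettiUniverse.hodge hHD (AbelianVariety.isSmoothProjective_holds (A := Z)) 1).hodgeLie,
      ∀ X' ∈ (BettiUniverse.hodge hHD (AbelianVariety.isSmoothProjective_holds (A := Z)) 1).hodgeLie, X * X' = X' * X := by
  intro X hX X' hX'
  have hcm : IsOfCMType Z := h.isOfCMType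
  have hle := hodgeLie_hodge_le_endAlg_of_isOfCMType hHD hI (AbelianVariety.isSmoothProjective_holds (A := Z)) hcm
  exact (BettiUniverse.hodge hHD _ 1).commute_of_mem_hodgeLie hX ⟨X', hle hX'⟩

/-! ### §2 Every polarization of `H¹` of a simple CM abelian variety is compatible with the CM action -/

/-- For a SIMPLE CM realisation, `End_Hdg(H¹Z)` is the image of the CM field: every Hodge endomorphism is `k^*` for some
`k ∈ K` (`dim End_Hdg = dim End⁰(Z)` — Riemann, `finrank_endAlg_hodge_one` — `= [K:ℚ]` for `Z` simple,
`isSimple_iff_finrank_endAlgebra_eq`; the action is injective). [cite: Shimura1998, §5.1 Prop. 6] -/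
theorem CMTorusTheta.exists_cmAction_eq_of_mem_endAlg_of_isSimple [IsCMField K] (h : IsCMTypeRealisation Φ Z ι θ)
    (hZs : Z.IsSimple) (hHD : exists_isReal_hodgeModel) (hI : hodgePQ_independent_of_hodgeModel)
    {a : Module.End ℚ (bettiCohomology Z.X 1)}
    (ha : a ∈ (BettiUniverse.hodge hHD (AbelianVariety.isSmoothProjective_holds (A := Z)) 1).endAlg) :
    ∃ k : K, (BettiUniverse.cmAction θ h.isInducedOnIntegers k : Module.End ℚ (bettiCohomology Z.X 1)) = a := by
  set H := BettiUniverse.hodge hHD (AbelianVariety.isSmoothProjective_holds (A := Z)) 1 with hH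
  set η : K →ₐ[ℚ] Module.End ℚ (bettiCohomology Z.X 1) := BettiUniverse.cmAction θ h.isInducedOnIntegers with hη
  -- the range of the action, a subspace of `End_Hdg` of the same dimension
  have hηE : ∀ k, (η k : Module.End ℚ (bettiCohomology Z.X 1)) ∈ H.endAlg := fun k =>
    (BettiUniverse.cmEndAction θ h.isInducedOnIntegers hHD hI (AbelianVariety.isSmoothProjective_holds (A := Z))).ι_mem_endAlg k
  haveI : Module.Finite ℚ (bettiCohomology Z.X 1) := finite_bettiCohomology_one Z
  haveI : Nontrivial (bettiCohomology Z.X 1) := by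
    apply Module.nontrivial_of_finrank_pos (R := ℚ)
    rw [finrank_bettiCohomology_one Z, ← finrank_eq_two_mul_dim_of_isCMTypeRealisation h]
    exact Module.finrank_pos
  haveI : Nontrivial (Module.End ℚ (bettiCohomology Z.X 1)) := inferInstance
  have hinj : Function.Injective η := RingHom.injective η.toRingHom
  set R : Submodule ℚ (Module.End ℚ (bettiCohomology Z.X 1)) := LinearMap.range η.toLinearMap with hR
  have hRle : R ≤ Subalgebra.toSubmodule H.endAlg := by
    rintro _ ⟨k, rfl⟩
    exact hηE k
  have hRrank : Module.finrank ℚ R = Module.finrank ℚ K := by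
    rw [hR, LinearMap.finrank_range_of_inj]
    exact hinj
  have hErank : Module.finrank ℚ (Subalgebra.toSubmodule H.endAlg) = Module.finrank ℚ K := by
    rw [Subalgebra.finrank_toSubmodule, hH, finrank_endAlg_hodge_one hHD hI, (h.isSimple_iff_finrank_endAlgebra_eq).1 hZs]
  have hReq : R = Subalgebra.toSubmodule H.endAlg :=
    Submodule.eq_of_le_of_finrank_eq hRle (by rw [hRrank, hErank])
  have ha' : a ∈ R := by rw [hReq]; exact ha
  obtain ⟨k, hk⟩ := ha'
  exact ⟨k, hk⟩

/-- **Every polarization of `H¹(Z)`, `Z` a SIMPLE CM abelian variety, is compatible with the CM action**: `ψ(k v, w) = ψ(v, k̄ w)`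
(the Rosati involution of `ψ` preserves `End_Hdg(H¹Z) = K` and is positive, hence complex conjugation — Shimura's Lemma 2, the tree's
`EndAction.adjoint_ι_eq_ι_complexConj`). [cite: Shimura1998, §5.1 Lemma 2] [cite: vanGeemen1994HodgeAV, Lemma 5.2 (1)] -/
theorem CMTorusTheta.isCompatible_cmEndAction_of_isSimple [IsCMField K] (h : IsCMTypeRealisation Φ Z ι θ) (hZs : Z.IsSimple)
    (hHD : exists_isReal_hodgeModel) (hI : hodgePQ_independent_of_hodgeModel)
    (ψ : (BettiUniverse.hodge hHD (AbelianVariety.isSmoothProjective_holds (A := Z)) 1).Polarization) :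
    (BettiUniverse.cmEndAction θ h.isInducedOnIntegers hHD hI (AbelianVariety.isSmoothProjective_holds (A := Z))).IsCompatible
      ψ.form := by
  haveI : Module.Finite ℚ (bettiCohomology Z.X 1) := finite_bettiCohomology_one Z
  set A := BettiUniverse.cmEndAction θ h.isInducedOnIntegers hHD hI (AbelianVariety.isSmoothProjective_holds (A := Z)) with hA
  haveI : Nontrivial (bettiCohomology Z.X 1) := by
    apply Module.nontrivial_of_finrank_pos (R := ℚ)
    rw [finrank_bettiCohomology_one Z, ← finrank_eq_two_mul_dim_of_isCMTypeRealisation h]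
    exact Module.finrank_pos
  have hst : ∀ e : K, ψ.adjoint (A.ι e) ∈ Set.range A.ι := by
    intro e
    obtain ⟨k, hk⟩ := CMTorusTheta.exists_cmAction_eq_of_mem_endAlg_of_isSimple h hZs hHD hI
      (ψ.adjoint_mem_endAlg (A.ι_mem_endAlg e))
    exact ⟨k, hk⟩
  intro e v w
  rw [← EndAction.adjoint_ι_eq_ι_complexConj A ψ hst e, Polarization.form_apply_adjoint]

/-! ### §3 Endomorphism-commuting skew operators lie in `Lie Hg(H¹Z) ⊗ ℂ` -/

/-- An operator commuting with every `P_i ⊗ ℂ` commutes with `(Σ q_i • P_i) ⊗ ℂ`. [folklore] -/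
private theorem commute_baseChange_sum_smul {V : Type*} [AddCommGroup V] [Module ℚ V] {ι' : Type*} (s : Finset ι')
    (q : ι' → ℚ) (P : ι' → Module.End ℚ V) {z : Module.End ℂ (ℂ ⊗[ℚ] V)}
    (hz : ∀ i, z * (P i).baseChange ℂ = (P i).baseChange ℂ * z) :
    z * (∑ i ∈ s, q i • P i).baseChange ℂ = (∑ i ∈ s, q i • P i).baseChange ℂ * z := by
  classical
  induction s using Finset.induction_on with
  | empty => rw [Finset.sum_empty, LinearMap.baseChange_zero, mul_zero, zero_mul]
  | insert i s hi ih =>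
    rw [Finset.sum_insert hi, LinearMap.baseChange_add, LinearMap.baseChange_smul, mul_add, add_mul, mul_smul_comm,
      smul_mul_assoc, hz i, ih]

/-- **`hY₂` FOR A SIMPLE CM FACTOR OF PRIME DIMENSION.**  Let `Z` realise the CM type `(K; Φ)`, `Z` SIMPLE of PRIME dimension
(every simple CM threefold), and let `ψ` be ANY polarization of `H¹(Z)`.  Then every operator `z` on `H¹(Z;ℚ) ⊗ ℂ` commuting with
`(g^*)_ℂ` for every `g ∈ End(Z)` and skew for `ψ_ℂ` lies in `Lie Hg(H¹Z) ⊗ ℂ`: `z` commutes with the whole CM action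
(`cmAction k` is a rational combination of pull-backs of endomorphisms), the joint eigenspaces of the action are lines and `ψ` is
compatible (§2), so `z ∈ (K⁻ ·)_ℂ` (`mem_spanC_map_of_commute_of_skew`), and `K⁻ · ⊆ Lie Hg(H¹Z)` is the torus maximality of a
nondegenerate CM type (`CMTorusTheta.cmAction_mem_of_theta_mem_of_isSimple_of_prime`).
[cite: MoonenZarhin1999LowDim, §2 (2.3) and Thm. (2.7)] [cite: Deligne1982HodgeCycles, I §4 and Ex. 3.7] [cite: Shimura1998, §5.1 Lemma 2] -/
theorem CMTorusTheta.mem_hodgeLieC_of_forall_commute_pull_of_skew [IsCMField K] [HodgeTensorFacts.{0, 0}]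
    (h : IsCMTypeRealisation Φ Z ι θ) (hZs : Z.IsSimple) (hp : Z.dim.Prime) (hHD : exists_isReal_hodgeModel)
    (hI : hodgePQ_independent_of_hodgeModel)
    (ψ : (BettiUniverse.hodge hHD (AbelianVariety.isSmoothProjective_holds (A := Z)) 1).Polarization)
    {z : Module.End ℂ (ℂ ⊗[ℚ] bettiCohomology Z.X 1)}
    (hzc : ∀ g : Z ⟶ Z, z * ((bettiCohomology.map g.hom.hom.hom 1).hom).baseChange ℂ =
      ((bettiCohomology.map g.hom.hom.hom 1).hom).baseChange ℂ * z)
    (hzs : ∀ x y, ψ.form.baseChange ℂ (z x) y + ψ.form.baseChange ℂ x (z y) = 0) :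
    z ∈ (BettiUniverse.hodge hHD (AbelianVariety.isSmoothProjective_holds (A := Z)) 1).hodgeLieC := by
  classical
  haveI : Module.Finite ℚ (bettiCohomology Z.X 1) := finite_bettiCohomology_one Z
  let H := BettiUniverse.hodge hHD (AbelianVariety.isSmoothProjective_holds (A := Z)) 1
  let A := BettiUniverse.cmEndAction θ h.isInducedOnIntegers hHD hI (AbelianVariety.isSmoothProjective_holds (A := Z))
  have hAι : ∀ k, (A.ι k : Module.End ℚ (bettiCohomology Z.X 1)) = BettiUniverse.cmAction θ h.isInducedOnIntegers k :=
    fun k => rfl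
  -- `K⁻`
  obtain ⟨S, hS⟩ : ∃ S : Submodule ℚ K, ∀ y : K, y ∈ S ↔ IsCMField.complexConj K y = -y :=
    ⟨{ carrier := {y | IsCMField.complexConj K y = -y}
       add_mem' := fun {a b} ha hb => by
         simp only [Set.mem_setOf_eq] at ha hb ⊢
         rw [map_add, ha, hb, neg_add]
       zero_mem' := by simp
       smul_mem' := fun c y hy => by
         simp only [Set.mem_setOf_eq] at hy ⊢
         rw [map_rat_smul, hy, smul_neg] }, fun y => Iff.rfl⟩
  -- the eigenlines and the compatibility
  have hline : ∀ σ : K →+* ℂ, Module.finrank ℂ ↥(⨅ e : K, Module.End.eigenspace ((A.ι e).baseChange ℂ) (σ e)) = 1 :=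
    fun σ => BettiUniverse.finrank_eigenLine_eq_one θ h.isInducedOnIntegers hHD hI _ σ (h.2.2.2 σ).1
  have hcompat : A.IsCompatible ψ.form := CMTorusTheta.isCompatible_cmEndAction_of_isSimple h hZs hHD hI ψ
  -- `z` commutes with the whole CM action
  have hzι : ∀ e : K, z * (A.ι e).baseChange ℂ = (A.ι e).baseChange ℂ * z := by
    intro e
    have hAιe : (A.ι e : Module.End ℚ (bettiCohomology Z.X 1)) =
        ∑ i, (integralBasis K).repr e i •
          (BettiUniverse.cmAction θ h.isInducedOnIntegers (integralBasis K i) : Module.End ℚ (bettiCohomology Z.X 1)) := by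
      rw [hAι]
      conv_lhs => rw [← (integralBasis K).sum_repr e]
      simp only [map_sum, map_smul]
    have hbasis : ∀ i, (BettiUniverse.cmAction θ h.isInducedOnIntegers (integralBasis K i) :
        Module.End ℚ (bettiCohomology Z.X 1)) = (bettiCohomology.map (ι (RingOfIntegers.basis K i)).hom.hom.hom 1).hom := by
      intro i
      rw [integralBasis_apply]
      exact cmAction_eq_pull θ h.isInducedOnIntegers (h.2.2.1 (RingOfIntegers.basis K i))
    rw [hAιe]
    simp only [hbasis]
    exact commute_baseChange_sum_smul _ _ _ fun i => hzc _
  -- `z ∈ (K⁻ ·)_ℂ`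
  have hzS : z ∈ spanC (S.map A.ι.toLinearMap) := A.mem_spanC_map_of_commute_of_skew S hS hline ψ hcompat hzι hzs
  -- `(K⁻ ·) ⊆ Lie Hg(H¹Z)` (torus maximality), complexified
  have hTheta := exists_hodgeTheta H
  obtain ⟨Θ, hΘ⟩ := hTheta
  have hΘ𝔤 : Θ ∈ spanC H.hodgeLie := (hodgeLieC_eq_spanC H) ▸ H.mem_hodgeLieC_of_forall_piece hΘ
  have hcomm𝔥 : ∀ X ∈ H.hodgeLie, ∀ k : K,
      X * BettiUniverse.cmAction θ h.isInducedOnIntegers k = BettiUniverse.cmAction θ h.isInducedOnIntegers k * X :=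
    fun X hX k => H.commute_of_mem_hodgeLie hX ⟨_, (hAι k) ▸ A.ι_mem_endAlg k⟩
  have hle : spanC (S.map A.ι.toLinearMap) ≤ H.hodgeLieC := by
    unfold spanC
    rw [Submodule.span_le]
    rintro _ ⟨Y₀, hY₀, rfl⟩
    obtain ⟨y, hy, rfl⟩ := Submodule.mem_map.1 hY₀
    have hu : IsCMField.complexConj K y = -y := (hS y).1 hy
    have hmem : (BettiUniverse.cmAction θ h.isInducedOnIntegers y : Module.End ℚ (bettiCohomology Z.X 1)) ∈ H.hodgeLie :=
      CMTorusTheta.cmAction_mem_of_theta_mem_of_isSimple_of_prime h hZs hp hHD hI H.hodgeLie hcomm𝔥 hΘ hΘ𝔤 hu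
    change ((A.ι.toLinearMap y) : Module.End ℚ (bettiCohomology Z.X 1)).baseChange ℂ ∈ H.hodgeLieC
    rw [AlgHom.toLinearMap_apply, hAι]
    exact baseChange_mem_hodgeLieC H hmem
  exact hle hzS

end Literature.AlgebraicGeometry.HodgeTheory

end
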